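import Mathlib
import Literature.MathematicalPhysics.QuantumFieldTheory.BalabanImbrieJaffe1984to88.BIJ88Sect3Statements

/-!
# `BalabanImbrieJaffe1984to88.BIJ88Eq317Series` — T. Bałaban, J. Imbrie, A. Jaffe, *Effective action and cluster
properties of the abelian Higgs model*, Commun. Math. Phys. **114** (1988) 257–315 [BalabanImbrieJaffe1988]: Sect. 3
"The First Renormalization Step", display **(3.17)** p. 267 — the expansion of the observable factors
`(ie₀)⁻¹ε^{−d/2}(u(p) − 1)` in powers of the field strength `f₀(p)`: the printed INFINITE SERIES member PROVED
(exponential series), and *"The others are included in F_irr(p)"* PROVED (`F_irr` = the tail `n ≥ 4`), with the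
elementary tail bound

statement-level skeleton of published theorems with citation tags; proofs where landed; nothing here is a
claim about the Yang–Mills mass gap

PDF held: `paper:balaban1988-cmp114-bij-abelian-higgs-effective-action` (journal page = PDF page + 256); p. 267 [PDF 11] read
in the text layer (the display itself is quoted from the C2 §§1–4 owner's transcription in `BIJ88Sect3Statements.Frel`,
unit `lit-balaban-r18`, row C2.Eq3.17 of `HOME/lit-balaban-r18/ROWS-C2.md`).

CITATION HEADER (lean-in-tree rule).  lit-balaban TYPED SKELETON, PHASE 2 (HOME `run/shared/lean/pub/lit-balaban/`); proof
seat p27, generation 3 (unit `lit-balaban-p27`; TAKING line HOME/STATUS.md 2026-08-21T03:19:27Z); row owner `lit-balaban-r18`;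
referee group ref-5.  WHAT IS REPRODUCED: SKELETON row **C2.Eq3.17**, verbatim p. 267: *"For factors (ieε²)⁻¹(u(p)−1) =
(ie₀)⁻¹ε^{−d/2}(u(p)−1) in the observable F, p ∈ Λ₀^{(0)**}, we expand:
  (ie(ε))⁻¹ε^{−d/2}(u(p)−1) = Σ_{n=1}^∞ ε^{−d/2}((ie₀)^{n−1}/n!)(f₀(p))ⁿ = F_rel(p) + F_irr(p).   (3.17)
The first three terms are relevant (for observables this means they do not go to zero with ε.) The others are included
in F_irr(p)."*; p. 267 earlier: *"(These are terms bounded by a high power of rescaled coupling constants.)"*.  The tree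
(`BIJ88Sect3Statements`, r18) types `F_rel` = the terms n = 1, 2, 3 (`Frel`), DEFINES `F_irr` as the left side minus `F_rel`
(`Firr`) and proves the outer equality by definition (`eq317`); the middle member — the series — was not typed.  HERE:
(i) `hasSum_eq317` — for `u(p) = exp(ie₀f₀(p))` (this is (3.15)/(3.26), `f₀ = (ie₀)⁻¹log u`: `exp_fieldStrength`) the series
`Σ_{n≥1} ε^{−d/2}((ie₀)^{n−1}/n!)f₀ⁿ` converges to `(ie₀)⁻¹ε^{−d/2}(u − 1)` (Mathlib `NormedSpace.expSeries_div_hasSum_exp`);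
(ii) `Frel_eq_sum_range` — `F_rel` is its partial sum of the first three terms; (iii) `hasSum_Firr` / `Firr_eq_tsum` — `F_irr` IS
the sum of the remaining terms `n ≥ 4`; (iv) `norm_Firr_le` — the tail bound `‖F_irr(p)‖ ≤ (5/96)·ε^{−d/2}|e₀|³‖f₀(p)‖⁴` for
`|e₀|‖f₀(p)‖ ≤ 1` (Mathlib `Complex.exp_bound`), i.e. in the small-field region (3.15) (`|f₀| ≦ p(e₀)`, `e₀p(e₀) ≤ 1`)
`‖F_irr(p)‖ ≤ (5/96)ε^{−d/2}e₀³p(e₀)⁴` (`norm_Firr_le_of_smallField`) — the quoted "high power of rescaled coupling constants".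
NOT ASSERTED: which terms are "relevant" (a statement about the ε → 0 behaviour inside expectations).  Theorems only; no `def`;
no `sorry`; axioms ⊆ {propext, Classical.choice, Quot.sound}.
-/

namespace Literature.MathematicalPhysics.QuantumFieldTheory.BalabanImbrieJaffe1984to88.BIJ88Eq317Series

open BIJ88Sect3Statements (Frel Firr fieldStrength)
open scoped BigOperators
open Complex

noncomputable section

/-- kernel: (3.15)/(3.26) inverted — for a plaquette variable `u ≠ 0` and `e₀ ≠ 0`, `u = exp(ie₀f₀)` with
`f₀ = (ie₀)⁻¹ log u` (`BIJ88Sect3Statements.fieldStrength`). [cite: BalabanImbrieJaffe1988, (3.17) p.267] -/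
theorem exp_fieldStrength {e₀ : ℝ} (he : e₀ ≠ 0) {u : ℂ} (hu : u ≠ 0) :
    exp (I * e₀ * fieldStrength e₀ u) = u := by
  have hIe : (I * e₀ : ℂ) ≠ 0 := mul_ne_zero I_ne_zero (ofReal_ne_zero.mpr he)
  rw [fieldStrength, ← mul_assoc, mul_inv_cancel₀ hIe, one_mul, exp_log hu]

/-- **(3.17), the series member, PROVED**: for `u = exp(ie₀f₀)`, `e₀ ≠ 0`, the series `Σ_{n=1}^∞ ε^{−d/2}((ie₀)^{n−1}/n!)f₀ⁿ`
(written with `n = m + 1`, `m ≥ 0`) converges, with sum `(ie₀)⁻¹ε^{−d/2}(u − 1)`. [cite: BalabanImbrieJaffe1988, (3.17) p.267] -/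
theorem hasSum_eq317 (ε : ℝ) {e₀ : ℝ} (he : e₀ ≠ 0) (d : ℕ) (f₀ : ℂ) :
    HasSum (fun m : ℕ => ((ε ^ (-(d : ℝ) / 2) : ℝ) : ℂ) * ((I * e₀) ^ m / (m + 1).factorial) * f₀ ^ (m + 1))
      ((I * e₀)⁻¹ * ((ε ^ (-(d : ℝ) / 2) : ℝ) : ℂ) * (exp (I * e₀ * f₀) - 1)) := by
  have hIe : (I * e₀ : ℂ) ≠ 0 := mul_ne_zero I_ne_zero (ofReal_ne_zero.mpr he)
  set x : ℂ := I * e₀ * f₀ with hx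
  -- the exponential series, first term removed
  have h0 : HasSum (fun n : ℕ => x ^ n / n.factorial) (exp x) := by
    rw [Complex.exp_eq_exp_ℂ]
    exact NormedSpace.expSeries_div_hasSum_exp x
  have h1 : HasSum (fun n : ℕ => x ^ (n + 1) / (n + 1).factorial) (exp x - 1) := by
    have := (hasSum_nat_add_iff' (f := fun n : ℕ => x ^ n / n.factorial) 1).mpr h0
    simpa using this
  -- multiply by the constant (ie₀)⁻¹ ε^{−d/2} and identify the terms
  have h2 := h1.mul_left ((I * e₀)⁻¹ * ((ε ^ (-(d : ℝ) / 2) : ℝ) : ℂ))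
  refine h2.congr_fun fun m => ?_
  have hf : ((m + 1).factorial : ℂ) ≠ 0 := by exact_mod_cast Nat.factorial_ne_zero _
  have he' : (e₀ : ℂ) ≠ 0 := ofReal_ne_zero.mpr he
  rw [hx]
  field_simp
  ring

/-- kernel: `F_rel` (the terms n = 1, 2, 3 of (3.17), `BIJ88Sect3Statements.Frel`) is the third partial sum of that series.
[cite: BalabanImbrieJaffe1988, (3.17) p.267] -/
theorem Frel_eq_sum_range (ε e₀ : ℝ) (d : ℕ) (f₀ : ℂ) :
    Frel ε e₀ d f₀ = ∑ m ∈ Finset.range 3,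
      ((ε ^ (-(d : ℝ) / 2) : ℝ) : ℂ) * ((I * e₀) ^ m / (m + 1).factorial) * f₀ ^ (m + 1) := by
  rw [Frel, Finset.range_eq_Ico, show Finset.Icc 1 3 = Finset.Ico (0 + 1) (3 + 1) from rfl, ← Finset.sum_Ico_add']
  refine Finset.sum_congr rfl fun m _ => ?_
  simp only [Nat.add_sub_cancel]

/-- **(3.17), "The others are included in F_irr(p)" PROVED**: for `u = exp(ie₀f₀)`, `e₀ ≠ 0`, the tree's `F_irr`
(`BIJ88Sect3Statements.Firr`, defined as the left side of (3.17) minus `F_rel`) is the sum of the terms `n ≥ 4` of the series.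
[cite: BalabanImbrieJaffe1988, (3.17) p.267] -/
theorem hasSum_Firr (ε : ℝ) {e₀ : ℝ} (he : e₀ ≠ 0) (d : ℕ) (f₀ : ℂ) :
    HasSum (fun m : ℕ => ((ε ^ (-(d : ℝ) / 2) : ℝ) : ℂ) * ((I * e₀) ^ (m + 3) / (m + 4).factorial) * f₀ ^ (m + 4))
      (Firr ε e₀ d (exp (I * e₀ * f₀)) f₀) := by
  have h := (hasSum_nat_add_iff'
    (f := fun m : ℕ => ((ε ^ (-(d : ℝ) / 2) : ℝ) : ℂ) * ((I * e₀) ^ m / (m + 1).factorial) * f₀ ^ (m + 1)) 3).mpr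
    (hasSum_eq317 ε he d f₀)
  rw [← Frel_eq_sum_range] at h
  unfold Firr
  convert h using 2 with m

/-- **(3.17)**: `F_irr(p) = Σ'_{n ≥ 4} ε^{−d/2}((ie₀)^{n−1}/n!)f₀(p)ⁿ` for `u(p) = exp(ie₀f₀(p))`. [cite: BalabanImbrieJaffe1988, (3.17) p.267] -/
theorem Firr_eq_tsum (ε : ℝ) {e₀ : ℝ} (he : e₀ ≠ 0) (d : ℕ) (f₀ : ℂ) :
    Firr ε e₀ d (exp (I * e₀ * f₀)) f₀ =
      ∑' m : ℕ, ((ε ^ (-(d : ℝ) / 2) : ℝ) : ℂ) * ((I * e₀) ^ (m + 3) / (m + 4).factorial) * f₀ ^ (m + 4) :=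
  (hasSum_Firr ε he d f₀).tsum_eq.symm

/-- **(3.17)** for the plaquette variable itself: with `f₀(p) = (ie₀)⁻¹log u(p)` ((3.15)), `u(p) ≠ 0`,
`(ie₀)⁻¹ε^{−d/2}(u(p) − 1) = Σ_{n≥1} ε^{−d/2}((ie₀)^{n−1}/n!)f₀(p)ⁿ`. [cite: BalabanImbrieJaffe1988, (3.17) p.267] -/
theorem hasSum_eq317_plaquette (ε : ℝ) {e₀ : ℝ} (he : e₀ ≠ 0) (d : ℕ) {u : ℂ} (hu : u ≠ 0) :
    HasSum (fun m : ℕ => ((ε ^ (-(d : ℝ) / 2) : ℝ) : ℂ) * ((I * e₀) ^ m / (m + 1).factorial) * fieldStrength e₀ u ^ (m + 1))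
      ((I * e₀)⁻¹ * ((ε ^ (-(d : ℝ) / 2) : ℝ) : ℂ) * (u - 1)) := by
  have h := hasSum_eq317 ε he d (fieldStrength e₀ u)
  rwa [exp_fieldStrength he hu] at h

/-- kernel: `F_irr` as the exponential tail — `F_irr = (ie₀)⁻¹ε^{−d/2}(exp(ie₀f₀) − Σ_{n<4}(ie₀f₀)ⁿ/n!)`.
[cite: BalabanImbrieJaffe1988, (3.17) p.267] -/
theorem Firr_eq_exp_sub_sum (ε : ℝ) {e₀ : ℝ} (he : e₀ ≠ 0) (d : ℕ) (f₀ : ℂ) :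
    Firr ε e₀ d (exp (I * e₀ * f₀)) f₀ =
      (I * e₀)⁻¹ * ((ε ^ (-(d : ℝ) / 2) : ℝ) : ℂ) *
        (exp (I * e₀ * f₀) - ∑ n ∈ Finset.range 4, (I * e₀ * f₀) ^ n / n.factorial) := by
  have he' : (e₀ : ℂ) ≠ 0 := ofReal_ne_zero.mpr he
  unfold Firr
  rw [Frel_eq_sum_range]
  simp only [Finset.sum_range_succ, Finset.sum_range_zero, Nat.factorial]
  push_cast
  field_simp
  ring

/-- **(3.17), the tail bound** (p. 267: *"(These are terms bounded by a high power of rescaled coupling constants.)"*):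
for `|e₀|·‖f₀(p)‖ ≤ 1`, `‖F_irr(p)‖ ≤ (5/96)·ε^{−d/2}·|e₀|³·‖f₀(p)‖⁴` (`ε > 0`; Mathlib `Complex.exp_bound` with four terms).
[cite: BalabanImbrieJaffe1988, (3.17) p.267] -/
theorem norm_Firr_le {ε e₀ : ℝ} (hε : 0 < ε) (he : e₀ ≠ 0) (d : ℕ) {f₀ : ℂ} (hsmall : |e₀| * ‖f₀‖ ≤ 1) :
    ‖Firr ε e₀ d (exp (I * e₀ * f₀)) f₀‖ ≤ 5 / 96 * ε ^ (-(d : ℝ) / 2) * |e₀| ^ 3 * ‖f₀‖ ^ 4 := by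
  have hx : ‖I * (e₀ : ℂ) * f₀‖ = |e₀| * ‖f₀‖ := by
    rw [norm_mul, norm_mul, norm_I, one_mul, norm_real, Real.norm_eq_abs]
  have hb := Complex.exp_bound (x := I * e₀ * f₀) (by rwa [hx]) (show 0 < 4 by norm_num)
  rw [hx] at hb
  have hεd : 0 < ε ^ (-(d : ℝ) / 2) := Real.rpow_pos_of_pos hε _
  have hc : ‖(I * (e₀ : ℂ))⁻¹ * (((ε ^ (-(d : ℝ) / 2) : ℝ) : ℂ))‖ = |e₀|⁻¹ * ε ^ (-(d : ℝ) / 2) := by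
    rw [norm_mul, norm_inv, norm_mul, norm_I, one_mul, norm_real, norm_real, Real.norm_eq_abs, Real.norm_eq_abs,
      abs_of_pos hεd]
  rw [Firr_eq_exp_sub_sum ε he d f₀, norm_mul, hc]
  have he0 : 0 < |e₀| := abs_pos.mpr he
  calc |e₀|⁻¹ * ε ^ (-(d : ℝ) / 2) * ‖exp (I * e₀ * f₀) - ∑ n ∈ Finset.range 4, (I * e₀ * f₀) ^ n / n.factorial‖
      ≤ |e₀|⁻¹ * ε ^ (-(d : ℝ) / 2) *
          ((|e₀| * ‖f₀‖) ^ 4 * (((4 : ℕ).succ : ℝ) * ((Nat.factorial 4 : ℝ) * (4 : ℕ))⁻¹)) := by gcongr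
    _ = 5 / 96 * ε ^ (-(d : ℝ) / 2) * |e₀| ^ 3 * ‖f₀‖ ^ 4 := by
        simp only [Nat.factorial, Nat.succ_eq_add_one]
        push_cast
        field_simp
        ring

/-- **(3.17) in the small-field region (3.15)** (`|f₀(p)| ≦ p(e₀)`, with `e₀p(e₀) ≤ 1`, `e₀ > 0`, `ε > 0`):
`‖F_irr(p)‖ ≤ (5/96)·ε^{−d/2}·e₀³·p(e₀)⁴`. [cite: BalabanImbrieJaffe1988, (3.17) p.267] -/
theorem norm_Firr_le_of_smallField {ε e₀ p : ℝ} (hε : 0 < ε) (he : 0 < e₀) (d : ℕ) {f₀ : ℂ} (hf : ‖f₀‖ ≤ p)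
    (hp : e₀ * p ≤ 1) :
    ‖Firr ε e₀ d (exp (I * e₀ * f₀)) f₀‖ ≤ 5 / 96 * ε ^ (-(d : ℝ) / 2) * e₀ ^ 3 * p ^ 4 := by
  have hf0 : 0 ≤ ‖f₀‖ := norm_nonneg _
  have hsmall : |e₀| * ‖f₀‖ ≤ 1 := by
    rw [abs_of_pos he]
    exact (mul_le_mul_of_nonneg_left hf he.le).trans hp
  refine (norm_Firr_le hε he.ne' d hsmall).trans ?_
  rw [abs_of_pos he]
  have hεd : 0 < ε ^ (-(d : ℝ) / 2) := Real.rpow_pos_of_pos hε _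
  gcongr

end

end Literature.MathematicalPhysics.QuantumFieldTheory.BalabanImbrieJaffe1984to88.BIJ88Eq317Series
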